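import Summits.BirchSwinnertonDyer.BirchSwinnertonDyer.Theorems.ByReductionTypeAtTwoTorsionEulerCharH46AtPStrict
import Summits.BirchSwinnertonDyer.BirchSwinnertonDyer.Theorems.ByReductionTypeAtTwoTorsionEulerCharH46RealiserStrict
import Summits.BirchSwinnertonDyer.BirchSwinnertonDyer.Theorems.ByReductionTypeAtTwoTorsionEulerCharTMap
import Summits.BirchSwinnertonDyer.BirchSwinnertonDyer.Theorems.ByReductionTypeAtTwoGoodOrdTowerControlAllP
import Summits.BirchSwinnertonDyer.BirchSwinnertonDyer.Theorems.ThetaPartnerAtTwoSignedMainConjectureCMTwoRankZeroPTDeepSelmerTransport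
import Summits.BirchSwinnertonDyer.Rank1Residual.GaloisImage.LocalH1TorsionBounded
import Literature.NumberTheory.EllipticCurves.IwasawaSelmerTorsionLevelZeroProofs
import Literature.NumberTheory.EllipticCurves.IwasawaCoinvariantsRankProofs
import Literature.NumberTheory.EllipticCurves.SelmerCorankControlRatProofs
import Literature.NumberTheory.EllipticCurves.ArchimedeanH1CardLeTwo
import Literature.NumberTheory.EllipticCurves.LocalPointsOrdinaryKummerCongruenceProofs
import Literature.NumberTheory.EllipticCurves.KummerLeStrictKernelOfReductionProofs
import Literature.NumberTheory.EllipticCurves.BSDSelmerParityDokchitserTowerProofs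
import HarnessLib

set_option linter.dupNamespace false -- `…BirchSwinnertonDyer.BirchSwinnertonDyer…` is the cell's nested layout (D-0017)
set_option autoImplicit false

/-!
# H46 kernel programme (road C′), socket (HB6) at LEVEL ZERO — inputs: a uniform killing exponent for the pushed dual classes
# (Mazur control + local finiteness) and the local «Galois-invariant modulo `E₁`» lemma at `p`

Cell `bsd-2adic` (run/shared/lean/pub/bsd-2adic/), seat `bsd-2adic-tower-1` GEN 35; `--supports stmt-BirchSwinnertonDyer-19271`
(helper, item `OrdKatoHalfAtTwo`, TOWER road). THEOREMS ONLY (no definition, no named fact, no instance, no `sorry`); closes no item;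
nothing booked; BSD is not proved by any of this.

GEN 34 reduced the remaining socket (HB6) of `TorsionEulerChar.H46Assembly.exists_realiser_of_sockets` (p735305) to the vanishing
`cores (r_* b) = 0` in `H¹(Γ_ℚ, E[p^j])` of the reduced corestriction of every ♭-dual class `b ∈ H¹(Γ_n, E[p^N])` (unramified outside
`S ∪ {v₀}`, Greenberg-STRICT at `p`), `N ≫ j` (B6a, p735807). AT THE LEVEL `n = 0` no universal-norm argument is needed: this file
supplies the two inputs of the level-zero proof (sibling `…TorsionEulerCharH46LevelZero.lean`):

* §1 `pow_padicValNat_nsmul_eq_zero` — if `c • x = 0`, `c ≠ 0`, and `p^N • x = 0` then `p^{v_p(c)} • x = 0`;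
* §2 **`exists_nsmul_mem_localKernelOfReduction_of_forall_smul_sub_mem`** / **`exists_pow_nsmul_mem_localKernelOfReduction_of_forall_smul_sub_mem`**
  — at a place `v` of GOOD reduction there is `M₀ > 0` (resp. `j₀`) such that every point `R ∈ E(K̄_v)` which is `Γ_{K_v}`-invariant
  modulo the kernel of reduction `E₁(K̄_v)` satisfies `M₀ • R ∈ E₁(K̄_v)` (resp. `p^{j₀} • R ∈ E₁(K̄_v)` when `R` is `p`-power torsion)
  — «its reduction is a rational point of the finite group `Ẽ(k_v)`» (`exists_finset_sub_mem_localKernelOfReduction_of_isArithFrobAt_pow`,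
  `exists_nsmul_mem_localKernelOfReduction`);
* §3 **`exists_pow_nsmul_push_eq_zero`** — `K = ℚ`, `p` good ORDINARY, `κ` cyclotomic, `Sel_{p^∞}(E/ℚ)` FINITE, `S ⊇ {bad} ∪ {p}`, `v₀ ∉ S`:
  there is ONE exponent `m` such that for every level `N` and every `b ∈ H¹(Γ_0, E[p^N])` whose Shapiro lift is unramified outside
  `S ∪ {v₀}` and which is STRICT at `p`, the pushed class satisfies `p^m • push b = 0` in `H¹(Γ_0, E[p^∞])`. Proof: the restriction
  `T = h_0(push b) ∈ H¹(ℚ_∞, E[p^∞])` is Kummer at `p` (`H46AtP.conjH1_realiser_mem_localKerOver_of_mem_strictKer`) and at the good places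
  (B5 `…_mem_unramified`); at the finitely many places of `S ∖ {p}`, at `v₀` and at `∞` the local classes of `push b` are killed by a
  uniform power (`Rank1Residual.GaloisImage.exists_pow_smul_eq_zero_galoisCohomology_localGaloisModule` — Tate local duality at
  `v ∤ p` — and `finite_localH1_infinitePlace`); so a uniform multiple of `T` lies in `Sel_{p^∞}(E/ℚ_∞)^Γ`, FINITE by Mazur's control
  theorem (`GoodOrdTower.selmer_control_all`, `finite_selmerInfty_inf_layerInvariants_zero`); and `ker h_0` is finite (Lemma 3.1,
  `finite_subgroupResKer_kerSubgroup`).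

HONEST FRAMING: plumbing over tree theorems; H46 is not proved in this file; BSD is not proved by any of this.

References: [GreenbergLNM1716] §2 Props. 2.1–2.2 (pp. 70–73), §3 Lemma 3.1 (p. 86), Thm. 1.2, §4 Lemma 4.6 (p. 105);
[MilneADT2006] I Cor. 3.4; [SilvermanAEC2009] VII.2.1.
-/

noncomputable section

open scoped Classical NumberField

namespace Summit.BirchSwinnertonDyer.BirchSwinnertonDyer.Theorems

namespace TorsionEulerChar.H46LevelZero

open CategoryTheory Field NumberField IsDedekindDomain WeierstrassCurve
  Literature.NumberTheory.EllipticCurves Literature.NumberTheory.EllipticCurves.CyclotomicLayer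
  Literature.NumberTheory.EllipticCurves.GreenbergSelmer
  Literature.NumberTheory.GaloisRepresentations Literature.NumberTheory.GaloisRepresentations.DiscreteGaloisModule
  Literature.NumberTheory.GaloisCohomology ZpExtension
open _root_.TopRep _root_.ContinuousCohomology

/-! ## §1 Arithmetic of exponents -/

/-- If `c • x = 0` with `c ≠ 0` and `x` is `p`-power torsion, then `p^{v_p(c)} • x = 0` (the order of `x` is a power of `p` dividing `c`).
[folklore] -/
theorem pow_padicValNat_nsmul_eq_zero {A : Type*} [AddCommGroup A] (p : ℕ) [hp : Fact p.Prime] {c N : ℕ} (hc : c ≠ 0) {x : A}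
    (hcx : c • x = 0) (hNx : p ^ N • x = 0) : p ^ padicValNat p c • x = 0 := by
  have hdvd : addOrderOf x ∣ p ^ N := addOrderOf_dvd_iff_nsmul_eq_zero.mpr hNx
  obtain ⟨i, -, hi⟩ := (Nat.dvd_prime_pow hp.out).mp hdvd
  have hic : p ^ i ∣ c := hi ▸ addOrderOf_dvd_iff_nsmul_eq_zero.mpr hcx
  have hile : i ≤ padicValNat p c := (padicValNat_dvd_iff_le hc).mp hic
  obtain ⟨d, hd⟩ := Nat.exists_eq_add_of_le hile
  rw [hd, pow_add, mul_nsmul, ← hi, addOrderOf_nsmul_eq_zero, nsmul_zero]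

/-! ## §2 The local lemma at a place of good reduction: Galois-invariant modulo `E₁` ⟹ a bounded multiple lies in `E₁` -/

section Local

variable {K : Type} [Field K] [NumberField K] (W : WeierstrassCurve K) [W.IsElliptic] (v : HeightOneSpectrum (𝓞 K))

/-- **Points of `E(K̄_v)` that are `Γ_{K_v}`-invariant modulo `E₁(K̄_v)` have BOUNDED order modulo `E₁(K̄_v)`** (good reduction at `v`):
there is `M₀ > 0` with `M₀ • R ∈ E₁(K̄_v)` for every such `R` — its reduction is a `k_v`-rational point of the FINITE group `Ẽ(k_v)`
(`exists_finset_sub_mem_localKernelOfReduction_of_isArithFrobAt_pow` for a Frobenius and `N₀ = 1`: finitely many classes modulo `E₁`; each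
representative has a positive multiple in `E₁`, `exists_nsmul_mem_localKernelOfReduction`). [cite: GreenbergLNM1716, §2 Props. 2.1–2.2 (pp. 70–73)]
[cite: SilvermanAEC2009, Prop. VII.2.1] -/
theorem exists_nsmul_mem_localKernelOfReduction_of_forall_smul_sub_mem (hgood : W.HasGoodReductionAt v) :
    ∃ M₀ : ℕ, 0 < M₀ ∧ ∀ R : localPoints W (v.adicCompletion K),
      (∀ τ : absoluteGaloisGroup (v.adicCompletion K), τ • R - R ∈ W.localKernelOfReduction v) →
        M₀ • R ∈ W.localKernelOfReduction v := by
  classical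
  obtain ⟨𝔐, h𝔐⟩ := v.localPrimesAbove_nonempty
  obtain ⟨σ₀, hσ₀⟩ := IsDedekindDomain.HeightOneSpectrum.exists_isArithFrobAt_localAbsIntegers v h𝔐
  obtain ⟨T, hT⟩ := W.exists_finset_sub_mem_localKernelOfReduction_of_isArithFrobAt_pow hgood h𝔐 hσ₀ (N₀ := 1) one_pos
  choose n hn using fun t : localPoints W (v.adicCompletion K) ↦ W.exists_nsmul_mem_localKernelOfReduction v hgood t
  refine ⟨∏ t ∈ T, n t, Finset.prod_pos fun t _ ↦ (hn t).1, fun R hR ↦ ?_⟩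
  obtain ⟨t, htT, hRt⟩ := hT R (by rw [pow_one]; exact hR σ₀)
  obtain ⟨d, hd⟩ := Finset.dvd_prod_of_mem n htT
  have h1 : (∏ t ∈ T, n t) • R = (∏ t ∈ T, n t) • (R - t) + d • (n t • t) := by
    rw [← mul_nsmul, ← hd, nsmul_sub, sub_add_cancel]
  rw [h1]
  exact AddSubgroup.add_mem _ (AddSubgroup.nsmul_mem _ hRt _) (AddSubgroup.nsmul_mem _ (hn t).2 _)

/-- **`p`-power torsion points of `E(K̄_v)` that are `Γ_{K_v}`-invariant modulo `E₁(K̄_v)`: `p^{j₀} • R ∈ E₁(K̄_v)` for a uniform `j₀`**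
(good reduction at `v`; `j₀ = v_p(M₀)` for the `M₀` of the previous theorem, the prime-to-`p` part of `M₀` acting invertibly on a `p`-power
torsion class of `E(K̄_v)/E₁(K̄_v)`). [cite: GreenbergLNM1716, §2 Props. 2.1–2.2 (pp. 70–73)] [cite: SilvermanAEC2009, Prop. VII.2.1] -/
theorem exists_pow_nsmul_mem_localKernelOfReduction_of_forall_smul_sub_mem (p : ℕ) [Fact p.Prime] (hgood : W.HasGoodReductionAt v) :
    ∃ j₀ : ℕ, ∀ R : localPoints W (v.adicCompletion K),
      (∀ τ : absoluteGaloisGroup (v.adicCompletion K), τ • R - R ∈ W.localKernelOfReduction v) →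
        (∃ t : ℕ, p ^ t • R = 0) → p ^ j₀ • R ∈ W.localKernelOfReduction v := by
  obtain ⟨M₀, hM₀, hM⟩ := exists_nsmul_mem_localKernelOfReduction_of_forall_smul_sub_mem W v hgood
  refine ⟨padicValNat p M₀, fun R hR ⟨t, ht⟩ ↦ ?_⟩
  rw [← QuotientAddGroup.eq_zero_iff, QuotientAddGroup.mk_nsmul]
  refine pow_padicValNat_nsmul_eq_zero p hM₀.ne' (N := t) ?_ ?_
  · rw [← QuotientAddGroup.mk_nsmul, QuotientAddGroup.eq_zero_iff]
    exact hM R hR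
  · rw [← QuotientAddGroup.mk_nsmul, ht, QuotientAddGroup.mk_zero]

end Local

/-! ## §3 The uniform killing exponent for pushed ♭-dual classes at level zero -/

section Uniform

variable (W : WeierstrassCurve ℚ) [W.IsElliptic] [W.IsGloballyMinimal] (p : ℕ) [hp : Fact p.Prime] (κ : ZpExtension ℚ p)
  (hκ : κ.IsCyclotomic) (hord : IsOrdinaryAt W p) (S : Finset (HeightOneSpectrum (𝓞 ℚ)))
  (hS : ∀ v : HeightOneSpectrum (𝓞 ℚ), v ∉ S → ((p : ℕ) : 𝓞 ℚ) ∉ v.asIdeal ∧ W.HasGoodReductionAt v)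
  (v₀ : HeightOneSpectrum (𝓞 ℚ)) (hv₀ : v₀ ∉ S) (vp : HeightOneSpectrum (𝓞 ℚ)) (hvp : ((p : ℕ) : 𝓞 ℚ) ∈ vp.asIdeal)

omit [W.IsElliptic] [W.IsGloballyMinimal] in
/-- Every element of `Γ_ℚ` lies in the layer-`0` subgroup `κ⁻¹(p⁰ℤ_p)`. [folklore] -/
theorem mem_layerSubgroup_zero (σ : absoluteGaloisGroup ℚ) : σ ∈ κ.layerSubgroup 0 := by
  rw [κ.layerSubgroup_zero]; exact Subgroup.mem_top σ

omit [W.IsElliptic] [W.IsGloballyMinimal] in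
/-- The local subgroup of the layer `0` at any `ℚ`-field `E` is everything. [folklore] -/
theorem mem_localSubgroup_layerSubgroup_zero (E : Type) [Field E] [Algebra ℚ E] (τ : absoluteGaloisGroup E) :
    τ ∈ localSubgroup (κ.layerSubgroup 0) E := by
  rw [mem_localSubgroup_iff]; exact mem_layerSubgroup_zero p κ _

/-- A class of `H¹(H, E[m])` is killed by `m`. [folklore] -/
theorem zsmul_torsionH1Over_eq_zero {K : Type} [Field K] [NumberField K] (W : WeierstrassCurve K) (n : ℕ)
    (H : Subgroup (absoluteGaloisGroup K)) (b : W.torsionH1Over (n : ℤ) H) : n • b = 0 := by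
  obtain ⟨g, rfl⟩ := oneCocycleClass_surjective (discreteTopRep H (W.geomTorsion (n : ℤ))) b
  have hg : (n : ℤ) • g = 0 := by
    refine Subtype.ext (ContinuousMap.ext fun σ ↦ ?_)
    change (n : ℤ) • g.1 σ = 0
    exact Subtype.ext (by
      rw [AddSubgroupClass.coe_zsmul, ZeroMemClass.coe_zero]
      exact (mem_geomTorsion_iff W (n : ℤ) _).mp (g.1 σ).2)
  change n • oneCocycleClass (discreteTopRep H (W.geomTorsion (n : ℤ))) g =
    (0 : ↥(continuousCohomology 1 (discreteTopRep H (W.geomTorsion (n : ℤ)))))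
  rw [← Nat.cast_smul_eq_nsmul ℤ, ← oneCocycleClass_smul, hg, oneCocycleClass_zero]

omit [W.IsElliptic] [W.IsGloballyMinimal] in
/-- A `p`-power-torsion class of `H¹(U_0, E(Ē))` (`U_0` the local subgroup of the layer `0` at a finite place `w ∤ p`) is killed by the
uniform power `p^{N_w}` of `Rank1Residual.GaloisImage.exists_pow_smul_eq_zero_galoisCohomology_localGaloisModule` (transport along the
bijective restriction `H¹(Γ_{ℚ_w}, ·) → H¹(U_0, ·)`). [cite: MilneADT2006, Ch. I, Cor. 3.4] -/
theorem pow_nsmul_localH1_layerZero_eq_zero (E : Type) [Field E] [Algebra ℚ E] {Nw : ℕ}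
    (hNw : ∀ c : galoisCohomology (W.localGaloisModule E) 1, (∃ j : ℕ, ((p ^ j : ℕ) : ℤ) • c = 0) → ((p ^ Nw : ℕ) : ℤ) • c = 0)
    (x : discreteH1 (localSubgroup (κ.layerSubgroup 0) E) (localPoints W E)) {j : ℕ} (hx : p ^ j • x = 0) :
    p ^ Nw • x = 0 := by
  have hbij := bijective_resH1Hom_subgroupIncl (localPoints W E) (localSubgroup (κ.layerSubgroup 0) E)
    (mem_localSubgroup_layerSubgroup_zero p κ E)
  obtain ⟨y, rfl⟩ := hbij.2 x
  have hy : p ^ j • y = 0 := hbij.1 (by rw [map_nsmul, hx, map_zero])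
  have hy' := hNw y ⟨j, by rw [natCast_zsmul]; exact hy⟩
  rw [natCast_zsmul] at hy'
  have hy'' : p ^ Nw • y = 0 := hy'
  rw [← map_nsmul]
  exact (congrArg _ hy'').trans (map_zero _)

include hκ hord hS hv₀ hvp in
/-- **The uniform killing exponent.** `K = ℚ`, `p` good ORDINARY (`IsOrdinaryAt W p`), `κ` cyclotomic, `Sel_{p^∞}(E/ℚ)` finite, `S` a finite set
off which `E` has good reduction and `p ∉ v`, `v₀ ∉ S`, `vp ∋ p`. There is `m` such that for EVERY level `N` and every class
`b ∈ H¹(Γ_0, E[p^N])` (`Γ_0 = κ⁻¹(p⁰ℤ_p)`) whose Shapiro lift is unramified at every finite `w ∉ S ∪ {v₀}` and which is STRICT at `p`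
(`b ∈ (C_p[p^N]-datum).strictKer Γ_0`), the pushed class `push b ∈ H¹(Γ_0, E[p^∞])` satisfies `p^m • push b = 0`.
[cite: GreenbergLNM1716, Thm. 1.2, §3 Lemma 3.1 (p. 86), §4 Lemma 4.6 (p. 105)] [cite: MilneADT2006, Ch. I, Cor. 3.4] -/
theorem exists_pow_nsmul_push_eq_zero [Finite (W.selmerGroupPInfty p)] :
    ∃ m : ℕ, ∀ (N : ℕ) [Fintype (absoluteGaloisGroup ℚ ⧸ κ.layerSubgroup 0)]
      {s : absoluteGaloisGroup ℚ ⧸ κ.layerSubgroup 0 → absoluteGaloisGroup ℚ}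
      (hs : ∀ x : absoluteGaloisGroup ℚ ⧸ κ.layerSubgroup 0, (s x : absoluteGaloisGroup ℚ ⧸ κ.layerSubgroup 0) = x)
      (hs1 : s ((1 : absoluteGaloisGroup ℚ) : absoluteGaloisGroup ℚ ⧸ κ.layerSubgroup 0) = 1)
      [CompactSpace (absoluteGaloisGroup ℚ)]
      (b : W.torsionH1Over ((p : ℤ) ^ N) (κ.layerSubgroup 0)),
      (∀ w : HeightOneSpectrum (𝓞 ℚ), w ∉ S → w ∉ ({v₀} : Finset (HeightOneSpectrum (𝓞 ℚ))) →
        galoisCohomology.localization ((W.torsionGaloisModule ((p : ℤ) ^ N)).coind (κ.layerSubgroup 0) (κ.isOpen_layerSubgroup 0))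
            (Sum.inr w) 1
            (shapiroLift (W.torsionGaloisModule ((p : ℤ) ^ N)).toTopRep (κ.layerSubgroup 0) (κ.isOpen_layerSubgroup 0) hs hs1 b) ∈
          unramifiedSubgroup (GaloisRep.toLocal w
            ((W.torsionGaloisModule ((p : ℤ) ^ N)).coind (κ.layerSubgroup 0) (κ.isOpen_layerSubgroup 0))) 1) →
      b ∈ (W.kernelOfReductionLocalDatumTorsion ((p : ℤ) ^ N) vp).strictKer (κ.layerSubgroup 0) →
      p ^ m • resH1Hom (N := W.geomPrimaryTorsion p) (subgroupInclusion (le_refl (κ.layerSubgroup 0)))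
          (AddSubgroup.inclusion (AcSigned.geomTorsion_zpow_le_geomPrimaryTorsion W p N)) (fun _ _ ↦ rfl) b = 0 := by
  have hfin : Finite (W.selmerGroupPInfty p) := ‹_›
  -- (1) local exponents at the finite places `w ∤ p`
  have hbdAll : ∀ w : HeightOneSpectrum (𝓞 ℚ), ∃ Nw : ℕ, ((p : ℕ) : 𝓞 ℚ) ∉ w.asIdeal →
      ∀ c : galoisCohomology (W.localGaloisModule (w.adicCompletion ℚ)) 1,
        (∃ j : ℕ, ((p ^ j : ℕ) : ℤ) • c = 0) → ((p ^ Nw : ℕ) : ℤ) • c = 0 := by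
    intro w
    by_cases hpw : ((p : ℕ) : 𝓞 ℚ) ∈ w.asIdeal
    · exact ⟨0, fun h ↦ absurd hpw h⟩
    · obtain ⟨Nw, hNw⟩ := Rank1Residual.GaloisImage.exists_pow_smul_eq_zero_galoisCohomology_localGaloisModule W w p hpw
      exact ⟨Nw, fun _ ↦ hNw⟩
  choose Nf hNf using hbdAll
  -- (2) the infinite places: finite local cohomology
  have hinfAll : ∀ w : InfinitePlace ℚ, ∃ cw : ℕ, 0 < cw ∧
      ∀ x : galoisCohomology (W.localGaloisModule w.Completion) 1, cw • x = 0 := fun w ↦ by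
    haveI := W.finite_localH1_infinitePlace w
    exact ⟨Nat.card (galoisCohomology (W.localGaloisModule w.Completion) 1), Nat.card_pos,
      fun x ↦ addOrderOf_dvd_iff_nsmul_eq_zero.mp (addOrderOf_dvd_natCard x)⟩
  choose cinf hcinf using hinfAll
  -- (3) Mazur control at level `0` and Lemma 3.1
  have hp' : ∀ v : HeightOneSpectrum (𝓞 ℚ), (p : 𝓞 ℚ) ∈ v.asIdeal → W.HasGoodReductionAt v ∧ W.HasUnitRootAt v :=
    fun v hv ↦ W.hasGoodReductionAt_and_hasUnitRootAt_of_rat hord.1 hord.2 v hv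
  obtain ⟨B, hB⟩ := GoodOrdTower.selmer_control_all W κ hκ hp'
  have hF : Finite ↥(W.selmerInfty κ ⊓ W.layerInvariants κ 0) :=
    W.finite_selmerInfty_inf_layerInvariants_zero κ hfin (hB 0).2.2.1
  obtain ⟨γ, hγ⟩ := κ.exists_isTopGenerator
  have hK : Finite (subgroupResKer (W.geomPrimaryTorsion p) κ.kerSubgroup) := W.finite_subgroupResKer_kerSubgroup κ hγ
  -- the uniform multiplier
  refine ⟨padicValNat p (p ^ (insert v₀ S).sup Nf * (∏ w : InfinitePlace ℚ, cinf w) *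
    Nat.card ↥(W.selmerInfty κ ⊓ W.layerInvariants κ 0) * Nat.card (subgroupResKer (W.geomPrimaryTorsion p) κ.kerSubgroup)),
    fun N _ s hs hs1 _ b hunr hstrict ↦ ?_⟩
  have hMne : p ^ (insert v₀ S).sup Nf * (∏ w : InfinitePlace ℚ, cinf w) *
      Nat.card ↥(W.selmerInfty κ ⊓ W.layerInvariants κ 0) * Nat.card (subgroupResKer (W.geomPrimaryTorsion p) κ.kerSubgroup) ≠ 0 :=
    mul_ne_zero (mul_ne_zero (mul_ne_zero (pow_ne_zero _ hp.out.ne_zero) (Finset.prod_pos fun w _ ↦ (hcinf w).1).ne')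
      Nat.card_pos.ne') Nat.card_pos.ne'
  have hb0 : p ^ N • b = 0 := by
    have h := zsmul_torsionH1Over_eq_zero W (p ^ N) (κ.layerSubgroup 0)
    rw [Nat.cast_pow] at h
    exact h b
  refine pow_padicValNat_nsmul_eq_zero p hMne ?_ (N := N) ?_
  swap
  · -- `p^N • push b = 0`
    rw [← map_nsmul, hb0, map_zero]
  -- notation-free abbreviations, as equations
  have hconj0 : ∀ (σ : absoluteGaloisGroup ℚ) (y : W.subgroupH1 p (κ.layerSubgroup 0)),
      W.conjH1 p κ.kerSubgroup σ (W.layerToInfty κ 0 y) = W.layerToInfty κ 0 y := fun σ y ↦ by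
    rw [← W.layerToInfty_conjH1 κ, W.conjH1_of_mem_holds p (κ.layerSubgroup 0) (mem_layerSubgroup_zero p κ σ), AddMonoidHom.id_apply]
  -- (a) `A • push b` is locally trivial at the finite places `≠ vp` of `S ∪ {v₀}` and at `∞`, `A = p^a · ∏ c_w`
  have hlocfin : ∀ w ∈ insert v₀ S, w ≠ vp →
      W.localResOver p (κ.layerSubgroup 0) (w.adicCompletion ℚ)
        ((p ^ (insert v₀ S).sup Nf * ∏ w : InfinitePlace ℚ, cinf w) •
          resH1Hom (N := W.geomPrimaryTorsion p) (subgroupInclusion (le_refl (κ.layerSubgroup 0)))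
            (AddSubgroup.inclusion (AcSigned.geomTorsion_zpow_le_geomPrimaryTorsion W p N)) (fun _ _ ↦ rfl) b) = 0 := by
    intro w hw hwp
    -- places of `ℚ` above the same rational prime coincide (`Literature.…heightOneSpectrum_rat_eq_of_natCast_mem`, inlined)
    have hpw : ((p : ℕ) : 𝓞 ℚ) ∉ w.asIdeal := fun h ↦ hwp (Rat.HeightOneSpectrum.primesEquiv.injective (Subtype.ext
      ((Rat.HeightOneSpectrum.primesEquiv_eq_of_natCast_mem w hp.out h).trans
        (Rat.HeightOneSpectrum.primesEquiv_eq_of_natCast_mem vp hp.out hvp).symm)))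
    have hx : p ^ N • W.localResOver p (κ.layerSubgroup 0) (w.adicCompletion ℚ)
        (resH1Hom (N := W.geomPrimaryTorsion p) (subgroupInclusion (le_refl (κ.layerSubgroup 0)))
          (AddSubgroup.inclusion (AcSigned.geomTorsion_zpow_le_geomPrimaryTorsion W p N)) (fun _ _ ↦ rfl) b) = 0 := by
      rw [← map_nsmul, ← map_nsmul, hb0, map_zero, map_zero]
    have h1 := pow_nsmul_localH1_layerZero_eq_zero W p κ (w.adicCompletion ℚ) (hNf w hpw) _ hx
    obtain ⟨d, hd⟩ := Nat.exists_eq_add_of_le (Finset.le_sup (f := Nf) hw)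
    rw [map_nsmul, hd, pow_add, mul_assoc, mul_nsmul, h1, nsmul_zero]
  have hlocinf : ∀ w : InfinitePlace ℚ,
      W.localResOver p (κ.layerSubgroup 0) w.Completion
        ((p ^ (insert v₀ S).sup Nf * ∏ w : InfinitePlace ℚ, cinf w) •
          resH1Hom (N := W.geomPrimaryTorsion p) (subgroupInclusion (le_refl (κ.layerSubgroup 0)))
            (AddSubgroup.inclusion (AcSigned.geomTorsion_zpow_le_geomPrimaryTorsion W p N)) (fun _ _ ↦ rfl) b) = 0 := by
    intro w
    have hbij := bijective_resH1Hom_subgroupIncl (localPoints W w.Completion) (localSubgroup (κ.layerSubgroup 0) w.Completion)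
      (mem_localSubgroup_layerSubgroup_zero p κ w.Completion)
    obtain ⟨y, hy⟩ := hbij.2 (W.localResOver p (κ.layerSubgroup 0) w.Completion
      (resH1Hom (N := W.geomPrimaryTorsion p) (subgroupInclusion (le_refl (κ.layerSubgroup 0)))
        (AddSubgroup.inclusion (AcSigned.geomTorsion_zpow_le_geomPrimaryTorsion W p N)) (fun _ _ ↦ rfl) b))
    obtain ⟨d, hd⟩ := Finset.dvd_prod_of_mem cinf (Finset.mem_univ w)
    have hA : p ^ (insert v₀ S).sup Nf * (cinf w * d) = cinf w * (p ^ (insert v₀ S).sup Nf * d) := by ring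
    have h0 : cinf w • ((p ^ (insert v₀ S).sup Nf * d) • y) = 0 := (hcinf w).2 _
    rw [map_nsmul, ← hy, ← map_nsmul, hd, hA, mul_nsmul']
    exact (congrArg _ h0).trans (map_zero _)
  -- (b) the multiple `T₁ = h_0 (A • push b)` is Selmer over `ℚ_∞` and `Γ`-invariant
  have hT₁sel : W.layerToInfty κ 0 ((p ^ (insert v₀ S).sup Nf * ∏ w : InfinitePlace ℚ, cinf w) •
      resH1Hom (N := W.geomPrimaryTorsion p) (subgroupInclusion (le_refl (κ.layerSubgroup 0)))
        (AddSubgroup.inclusion (AcSigned.geomTorsion_zpow_le_geomPrimaryTorsion W p N)) (fun _ _ ↦ rfl) b) ∈ W.selmerInfty κ := by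
    refine TorsionEulerChar.mem_selmerInfty_of_realizes_zero W p κ v₀ _ (fun v hv σ ↦ ?_) (fun w σ ↦ ?_) (fun σ ↦ ?_)
    · rw [hconj0]
      by_cases hvp' : v = vp
      · subst hvp'
        rw [map_nsmul, ← hconj0 σ]
        exact AddSubgroup.nsmul_mem _ (H46AtP.conjH1_realiser_mem_localKerOver_of_mem_strictKer W p κ hκ 0 N v hvp
          (hp' v hvp).1 b hstrict σ) _
      · by_cases hvS : v ∈ S
        · refine W.resOfLe_mem_localKerOver p (v.adicCompletion ℚ) (κ.kerSubgroup_le_layerSubgroup 0) ?_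
          rw [W.mem_localKerOver_iff]
          exact hlocfin v (Finset.mem_insert_of_mem hvS) hvp'
        · rw [map_nsmul, ← hconj0 σ]
          exact AddSubgroup.nsmul_mem _ (H46Realiser.conjH1_realiser_mem_localKerOver_of_localization_shapiroLift_mem_unramified W p κ
            hκ 0 N hs hs1 v (hS v hvS).1 (hS v hvS).2
            (SignedLowerOffTwo.PTDeep.isUnramifiedAt_coind_torsionGaloisModule_layerSubgroup κ W 0 N (hS v hvS).1 (hS v hvS).2) b
            (hunr v hvS (fun h ↦ hv (Finset.mem_singleton.mp h))) σ) _
    · rw [hconj0]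
      refine W.resOfLe_mem_localKerOver p w.Completion (κ.kerSubgroup_le_layerSubgroup 0) ?_
      rw [W.mem_localKerOver_iff]
      exact hlocinf w
    · rw [hconj0]
      have hv₀p : v₀ ≠ vp := fun h ↦ (hS v₀ hv₀).1 (h ▸ hvp)
      have hmem : (p ^ (insert v₀ S).sup Nf * ∏ w : InfinitePlace ℚ, cinf w) •
          resH1Hom (N := W.geomPrimaryTorsion p) (subgroupInclusion (le_refl (κ.layerSubgroup 0)))
            (AddSubgroup.inclusion (AcSigned.geomTorsion_zpow_le_geomPrimaryTorsion W p N)) (fun _ _ ↦ rfl) b ∈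
          W.localKerOver p (κ.layerSubgroup 0) (v₀.adicCompletion ℚ) := by
        rw [W.mem_localKerOver_iff]
        exact hlocfin v₀ (Finset.mem_insert_self v₀ S) hv₀p
      exact (W.mem_localKerOver_iff p κ.kerSubgroup (v₀.adicCompletion ℚ) _).1
        (W.resOfLe_mem_localKerOver p (v₀.adicCompletion ℚ) (κ.kerSubgroup_le_layerSubgroup 0) hmem)
  have hT₁inv : W.layerToInfty κ 0 ((p ^ (insert v₀ S).sup Nf * ∏ w : InfinitePlace ℚ, cinf w) •
      resH1Hom (N := W.geomPrimaryTorsion p) (subgroupInclusion (le_refl (κ.layerSubgroup 0)))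
        (AddSubgroup.inclusion (AcSigned.geomTorsion_zpow_le_geomPrimaryTorsion W p N)) (fun _ _ ↦ rfl) b) ∈ W.layerInvariants κ 0 :=
    W.range_layerToInfty_le_layerInvariants_holds κ 0 ⟨_, rfl⟩
  -- (c) finiteness of `Sel_∞^Γ` kills `T₁`
  have hT₁zero : Nat.card ↥(W.selmerInfty κ ⊓ W.layerInvariants κ 0) •
      W.layerToInfty κ 0 ((p ^ (insert v₀ S).sup Nf * ∏ w : InfinitePlace ℚ, cinf w) •
        resH1Hom (N := W.geomPrimaryTorsion p) (subgroupInclusion (le_refl (κ.layerSubgroup 0)))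
          (AddSubgroup.inclusion (AcSigned.geomTorsion_zpow_le_geomPrimaryTorsion W p N)) (fun _ _ ↦ rfl) b) = 0 := by
    have h := addOrderOf_dvd_natCard (G := ↥(W.selmerInfty κ ⊓ W.layerInvariants κ 0)) ⟨_, AddSubgroup.mem_inf.mpr ⟨hT₁sel, hT₁inv⟩⟩
    have h' := addOrderOf_dvd_iff_nsmul_eq_zero.mp h
    rwa [Subtype.ext_iff, AddSubgroupClass.coe_nsmul, ZeroMemClass.coe_zero] at h'
  -- (d) the kernel of `h_0` is finite (Lemma 3.1): transport to `H¹(Γ_ℚ, ·)`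
  have hbij := bijective_resH1Hom_subgroupIncl (W.geomPrimaryTorsion p) (κ.layerSubgroup 0) (mem_layerSubgroup_zero p κ)
  obtain ⟨y, hy⟩ := hbij.2 (resH1Hom (N := W.geomPrimaryTorsion p) (subgroupInclusion (le_refl (κ.layerSubgroup 0)))
    (AddSubgroup.inclusion (AcSigned.geomTorsion_zpow_le_geomPrimaryTorsion W p N)) (fun _ _ ↦ rfl) b)
  have hcomp : ∀ z, W.layerToInfty κ 0 (resH1Hom (Literature.NumberTheory.EllipticCurves.subgroupIncl (κ.layerSubgroup 0))
      (AddMonoidHom.id (W.geomPrimaryTorsion p)) (fun _ _ ↦ rfl) z) =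
      Literature.NumberTheory.EllipticCurves.ResKernel.resSubgroup κ.kerSubgroup (W.geomPrimaryTorsion p) z := fun z ↦ by
    simp only [WeierstrassCurve.layerToInfty, WeierstrassCurve.resOfLe, Literature.NumberTheory.EllipticCurves.resOfLe,
      Literature.NumberTheory.EllipticCurves.ResKernel.resSubgroup, resH1Hom_resH1Hom]
    exact DFunLike.congr_fun (resH1Hom_congr (by ext; rfl) (by ext; rfl) _ _) z
  have hker : (Nat.card ↥(W.selmerInfty κ ⊓ W.layerInvariants κ 0) * (p ^ (insert v₀ S).sup Nf * ∏ w : InfinitePlace ℚ, cinf w)) • y ∈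
      subgroupResKer (W.geomPrimaryTorsion p) κ.kerSubgroup := by
    rw [ResKernel.mem_subgroupResKer_iff, ← hcomp, map_nsmul, hy, mul_nsmul', map_nsmul, hT₁zero]
  have hkill := addOrderOf_dvd_iff_nsmul_eq_zero.mp
    (addOrderOf_dvd_natCard (G := subgroupResKer (W.geomPrimaryTorsion p) κ.kerSubgroup) ⟨_, hker⟩)
  rw [Subtype.ext_iff, AddSubgroupClass.coe_nsmul, ZeroMemClass.coe_zero, ← mul_nsmul] at hkill
  -- conclusion
  rw [← hy, ← map_nsmul]
  have hM : p ^ (insert v₀ S).sup Nf * (∏ w : InfinitePlace ℚ, cinf w) * Nat.card ↥(W.selmerInfty κ ⊓ W.layerInvariants κ 0) *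
      Nat.card (subgroupResKer (W.geomPrimaryTorsion p) κ.kerSubgroup) =
      Nat.card ↥(W.selmerInfty κ ⊓ W.layerInvariants κ 0) * (p ^ (insert v₀ S).sup Nf * ∏ w : InfinitePlace ℚ, cinf w) *
        Nat.card (subgroupResKer (W.geomPrimaryTorsion p) κ.kerSubgroup) := by ring
  rw [hM, hkill, map_zero]

end Uniform

end TorsionEulerChar.H46LevelZero

end Summit.BirchSwinnertonDyer.BirchSwinnertonDyer.Theorems

end
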